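import Literature.MathematicalPhysics.QuantumFieldTheory.Balaban1983to89.B13XinvCentreDecayOfUnitary
import Literature.MathematicalPhysics.QuantumFieldTheory.Balaban1983to89.B13OpsYPencilXQuadGen
import Literature.MathematicalPhysics.QuantumFieldTheory.Balaban1983to89.B13GreenPrimeSymLettersOfReg335
import Literature.MathematicalPhysics.QuantumFieldTheory.Balaban1983to89.B13InverseOperatorCoordinates
import Literature.MathematicalPhysics.QuantumFieldTheory.Balaban1983to89.MatrixNorms

/-!
# `Balaban1983to89.B13XinvCentreDecayOfReg335` — T. Bałaban, *Propagators for lattice gauge theories in a background field*, Commun. Math. Phys. **99** (1985) 389–434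
# [Balaban1985BackgroundPropagators], Thm 3.2 (3.48) p. 398 ∕ (3.25) pp. 394–395 ∕ (3.35) p. 396 ∕ (3.66)–(3.70) pp. 403–404 ∕ Thm 3.10 (3.107)–(3.108) p. 416, with [4] =
# [Balaban1984PropagatorsII] Prop 2.3 p. 238; *Renormalization group approach … II*, Commun. Math. Phys. **116** (1988) 1–22 [Balaban1988RG2Cluster] (2.5)–(2.7) pp. 12–13,
# p. 15: ★ **THE X⁻¹ CENTRE FACT ON THE (3.35) CLASS IN THE JUNCTION's KERNEL CURRENCY** — step (ii) (the entry decay of the matrix of `X(U₀) = (Q′G′²Q′*)(U₀)` at def-Y's v4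
# letters) and the readout of the lane's module 81 to the X⁻¹-junction's binder `‖X(U₀)⁻¹(δ_s ⊗ E)(t)‖ ≤ B_X‖E‖e^{−κ·d₁(ℓB t, ℓB s)}`

statement-level skeleton of published theorems with citation tags; proofs where landed; nothing here is a claim about the Yang–Mills mass gap

THE PRINT.  Thm 3.2 p. 398: *«Under the assumptions of Theorem 3.1, and with the same constants, the following inequality holds: |(Q′(U)G′²(U)Q′\*(U))⁻¹(y,y′)| ≤
B₀(Lʲη)⁻⁴(Lʲ′η)^{−d}e^{−δ₀d(y,y′)} (3.48)»* (*«a theorem analogous to Proposition 2.3 of [4]»*); (3.66)–(3.70) pp. 403–404: *«the operator Q′G′²Q′\*(U′U) … analytic in A′»*.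

WHY THIS FILE (cell `pub-ymgap`, D-0062 ∕ D-0149 ∕ D-0154, Track A node N10 = [B13]; width seat `pub-ymgap-dag-n10-w5` g3, CLAIM-1 on the n10-c lane's LOCATED recipe «the X⁻¹
centre fact» (HOME INBOX l.29493) AS RE-SCOPED by the lane (l.29777): steps (i)(iii)(iv) are the lane's modules 80 `B13InverseDecayWeightedPairing` ∕ 81
`B13XinvCentreDecayOfUnitary`; THIS FILE = step (ii) + the kernel-shape readout).  n10-w2's X⁻¹-junction (`B13OpsYPencilXQuadGen.rawEntryLetters_toMatrix_XinvY_prodCfg_of_pencil_of`,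
v4 instance `…_parSymY_prodCfg_of_pencil`) DISPLAYS two N06 binders at the ONE real background `U₀`: `hunit : IsUnit (X(U₀))` and `hO : ‖XinvY …U₀ (δ_s ⊗ E)(t)‖ ≤
B_X‖E‖e^{−ρ d₁(ℓB t, ℓB s)}`.  Module 81 gives `IsUnit` (dag-n06-j) and the decay of the product-basis MATRIX of `X(U₀)⁻¹` at every `G`-valued background (n06-w1's coercivity
`trIP_XY_parSymY_ge` + module 80's weighted Combes–Thomas) MODULO the entry decay `hXdec` of the matrix of `X(U₀)`.  Here:
* §1 [folklore] ★ `norm_apply_single_le_of_toMatrix_piStd_decay` — THE READOUT: `‖toMatrix B′ B′ Φ p q‖ ≤ B·e^{−κ d₁(loc p.1, loc q.1)}` in the matrix-unit product basis ⟹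
  `‖Φ(δ_s ⊗ E)(t)‖ ≤ N³·B·‖E‖·e^{−κ d₁(loc t, loc s)}` (`LinearMap.toMatrix_mulVec_repr`, `|E_{ab}| ≤ ‖E‖`, `‖·‖ ≤ HS`; the converse of n10-w2's `toMatrix_decay_of_kernelBound`);
  81's weight-ratio numeral LOCATED: `sqrt_wB_le_mul_sqrt_wB` (`Θ = √((L^k)^{d+1})`, `B6Geom246MultiLevelBox.scale_bounds`); the volume numeral is 81 §4's
  (`c_V = m_B·c₀(1,κ₀∕2)^ν` from the junction's fibre bound of `ℓB ∘ fst`).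
* §2 ★ `rawEntryLetters_toMatrix_XY_parSymY_prodCfg_of_mem` (n10-w2's X-station `rawEntryLetters_toMatrix_XY_prodCfg_of` at `parSymY` for a `G`-valued background: the
  transporter facts by the lane's 78 §1, `K₀ = 1` by unitarity, the record's matrix units; letters' radius `R`, numeral radius `Rc ≥ R`), ★★ `norm_toMatrix_XY_parSymY_le_of_letters`
  — STEP (ii) modulo `G′`'s pencil letters: the `A′ = 0` clause (`prodCfg_zero`) = 81's `hXdec` at `loc := ℓB ∘ fst`.
* §3 ★★★ `norm_XinvY_parSymY_single_le_of_letters` (81 ∘ §2 ∘ §1, every `G`-valued `U₀`, `G′`'s letters displayed) and ★★★ `norm_XinvY_parSymY_single_le_of_reg335` (`G′`'s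
  letters DISCHARGED on the (3.35) class by the lane's 79 `…GpY_parSymY_prodCfg_of_reg335_record` — n06-w1's Thm 3.1 decay + dag-n06-j's invertibility — at its located thin
  radius, `thinRadius_pos`): `IsUnit (X(U₀)) ∧ ∀ s t E, ‖XinvY i (parSymY i) (GpY i (parSymY i)) U₀ (Pi.single s E) t‖ ≤ N³·(Θ·4∕m)·‖E‖·e^{−κ·d₁(ℓB t, ℓB s)}`,
  `m = (4(d+1)+1)⁻²`, displaying NODE 00's dictionary numerals and ONE located rate `κ` (`0 ≤ κ ≤ (ρ′−μ)∕4`, `8(Θa_X)κc_V ≤ m(ρ′−μ)`) — the junction's `hunit ∕ hO` at v4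
  (after `rawEntryLetters_mono` of the X-letters' rate down to `κ`).
HONEST FRAMING ∕ SCOPE: a composition of cited TREE theorems (n06-w1 ∕ dag-n06-j via 81; the lane's 78 ∕ 79 ∕ 80 ∕ 81; n10-w2's X-station) + [folklore] finite-matrix
bookkeeping; scope = n06-w1's (ONE finite lattice operator, rate per lattice step at the coarsest scale through the readings; NOT print's multi-scale `d(y,y′)`, NOT (3.48)'s
scale factors `(Lʲη)⁻⁴(Lʲ′η)^{−d}`); which `ℓS ∕ ℓB ∕ η ∕ U₀` and which letter family are «of record» is NODE 00's ∕ def-Y's ∕ def-T's word; the bond-sector `G = Δ_a⁻¹`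
(Thm 3.3) is NOT touched; nothing of Bałaban's asserted beyond the cited theorems; N06 ∕ N10 NOT discharged; K1⁷ NOT closed; counts unmoved (typed 28∕28 · discharged 5∕27);
THEOREMS ONLY (0 `def` ∕ `instance` ∕ `notation`), 0 `sorry`, standard axioms; one finite 𝕋⁴ programme at fixed ε — R4 closes the conditional finite-𝕋⁴ rung `BalabanLadder.UV`
only; the YM mass gap (Clay) is NOT proved by any of this; nothing continuum ∕ ℝ⁴ ∕ OS.

v1.0.1 (DOCSTRING-ONLY; declarations byte-identical): [B9] locators per lit-balaban-r06 g67 (HOME INBOX l.31667) — the (3.48) quotation's scale factor `(Lʲη)⁻⁴` (print p. 398), «(3.66)–(3.70)» pp. 403–404, «(3.25)» p. 394.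

References: T. Bałaban, CMP 99 (1985) 389–434 [Balaban1985BackgroundPropagators] (3.25) pp.394–395, (3.35) p.396, Thm 3.2 (3.48) pp.398–399, (3.66)–(3.70) pp.403–404, Thm 3.10
(3.107)–(3.108) p.416; CMP 96 (1984) 223–250 [Balaban1984PropagatorsII] Prop 2.3 p.238, Lemma 2.1 (2.61) p.234, (2.69) p.235; CMP 116 (1988) 1–22 [Balaban1988RG2Cluster]
(2.5)–(2.7) pp.12–13, p.15.
-/

noncomputable section

namespace Literature.MathematicalPhysics.QuantumFieldTheory.Balaban1983to89.B13XinvCentreDecayOfReg335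

open Metric Set Finset Module
open scoped Matrix ComplexConjugate Matrix.Norms.L2Operator
open Literature.MathematicalPhysics.QuantumFieldTheory.Balaban1983to89
open Node00 B6KLevelCensusIndexV1 B6Geom246MultiLevelBox B6MultiLevelBoxOperator B6MultiLevelTorusOperator B6GlobalChartV1 B9BackgroundsKLevelV1
open Literature.MathematicalPhysics.QuantumFieldTheory.Balaban1983to89.B4TorusKernel.MultiPeriod (torusSupNorm)
open Literature.MathematicalPhysics.QuantumFieldTheory.Balaban1983to89.B9Thm37GlueTorus (tdist1 tdist1_nonneg tdist1_comm)
open Literature.MathematicalPhysics.QuantumFieldTheory.Balaban1983to89.B5TorusCover (UT)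
open Literature.MathematicalPhysics.QuantumFieldTheory.Balaban1983to89.B9Thm311ReadingAtLetters (wB wB_pos)
open Literature.MathematicalPhysics.QuantumFieldTheory.Balaban1983to89.B9Eq39Adjoint (prodCfg)
open Literature.MathematicalPhysics.QuantumFieldTheory.Balaban1983to89.B9Eq369Product (prodCfg_zero)
open Literature.MathematicalPhysics.QuantumFieldTheory.Balaban1983to89.B13EntrywiseWalks (RawEntryLetters)
open Literature.MathematicalPhysics.QuantumFieldTheory.Balaban1983to89.B13InverseOperatorCoordinates (piProdBasis_repr)
open Literature.MathematicalPhysics.QuantumFieldTheory.Balaban1983to89.B13InverseLettersNeumannRadius (thinRadius_pos thinRadius_le)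
open Literature.MathematicalPhysics.QuantumFieldTheory.Balaban1983to89.B13MatrixUnitBasisNumerals (stdBasis_repr_apply norm_stdBasis_repr_le norm_stdBasis_le_one)
open Literature.MathematicalPhysics.QuantumFieldTheory.Balaban1983to89.B13OpsYPencilGreenPrimeSym
  (differentiableOn_parSymY_prodCfg differentiableOn_parSymY_inv_prodCfg norm_parSymY_prodCfg_le norm_parSymY_inv_prodCfg_le)
open Literature.MathematicalPhysics.QuantumFieldTheory.Balaban1983to89.B13GreenPrimeSymLettersOfReg335
  (norm_unit_le_one_of_mem rawEntryLetters_toMatrix_GpY_parSymY_prodCfg_of_reg335_record)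
open Literature.MathematicalPhysics.QuantumFieldTheory.Balaban1983to89.B13OpsYPencilXQuadGen (rawEntryLetters_toMatrix_XY_prodCfg_of)
open Literature.MathematicalPhysics.QuantumFieldTheory.Balaban1983to89.B13XinvCentreDecayOfUnitary (norm_toMatrix_XinvY_parSymY_le_of_unitary_fibre)

/-! ## §1. [folklore] The readout: product-basis entry decay ⟹ the junction's kernel shape; the located numeral `Θ` -/

section Readout

variable {S : Type} [Fintype S] [DecidableEq S] {N : ℕ} {ν : ℕ} {Nf : Fin ν → ℕ} [∀ j, NeZero (Nf j)]

/-- ★ **THE READOUT — PRODUCT-BASIS ENTRY DECAY ⟹ THE JUNCTION's KERNEL SHAPE**: `‖toMatrix B′ B′ Φ p q‖ ≤ B·e^{−κ d₁(loc p.1, loc q.1)}` in the matrix-unit product basis ⟹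
`‖Φ(δ_s ⊗ E)(t)‖ ≤ N³·B·‖E‖·e^{−κ d₁(loc t, loc s)}` (`(Φ(δ_s ⊗ E))(t)_{ab} = Σ_l M_{(t,ab),(s,l)}E_l`, `|E_l| ≤ ‖E‖`, `N²` probes, `‖·‖ ≤ HS ≤ N·max`). [folklore]
[cite: Balaban1985BackgroundPropagators, Thm 3.10 (3.107)–(3.108) p.416, (3.48) p.398, dictionary] -/
theorem norm_apply_single_le_of_toMatrix_piStd_decay (Φ : Module.End ℂ (S → Matrix (Fin N) (Fin N) ℂ)) (loc : S → UT Nf) {B κ : ℝ} (hB : 0 ≤ B)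
    (hdec : ∀ p q, ‖LinearMap.toMatrix ((Pi.basis fun _ : S => Matrix.stdBasis ℂ (Fin N) (Fin N)).reindex (Equiv.sigmaEquivProd S (Fin N × Fin N)))
        ((Pi.basis fun _ : S => Matrix.stdBasis ℂ (Fin N) (Fin N)).reindex (Equiv.sigmaEquivProd S (Fin N × Fin N))) Φ p q‖ ≤
      B * Real.exp (-(κ * tdist1 Nf (loc p.1) (loc q.1))))
    (s t : S) (E : Matrix (Fin N) (Fin N) ℂ) :
    ‖Φ (Pi.single s E) t‖ ≤ (N : ℝ) ^ 3 * B * ‖E‖ * Real.exp (-(κ * tdist1 Nf (loc t) (loc s))) := by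
  classical
  set Bs : Basis (S × (Fin N × Fin N)) ℂ (S → Matrix (Fin N) (Fin N) ℂ) :=
    (Pi.basis fun _ : S => Matrix.stdBasis ℂ (Fin N) (Fin N)).reindex (Equiv.sigmaEquivProd S (Fin N × Fin N)) with hBs
  set M : Matrix (S × (Fin N × Fin N)) (S × (Fin N × Fin N)) ℂ := LinearMap.toMatrix Bs Bs Φ with hM
  set f : S → Matrix (Fin N) (Fin N) ℂ := Pi.single s E with hf
  -- the product basis' coordinates are the entries (as `B13GreenCentreDecayOfCoercive.piStd_repr_apply`, inlined)
  have hrepr : ∀ (g : S → Matrix (Fin N) (Fin N) ℂ) (p : S × (Fin N × Fin N)), Bs.repr g p = g p.1 p.2.1 p.2.2 := fun g p => by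
    obtain ⟨s, a, b⟩ := p
    rw [hBs, piProdBasis_repr, stdBasis_repr_apply]
  -- the coordinates of `Φ f` are `M *ᵥ` the coordinates of `f`
  have hcoord : ∀ a b : Fin N, (Φ f t) a b = ∑ q, M (t, (a, b)) q * Bs.repr f q := fun a b => by
    have h := LinearMap.toMatrix_mulVec_repr Bs Bs Φ f
    have hp := congr_fun h (t, (a, b))
    rw [hrepr] at hp
    rw [← hp, hM, Matrix.mulVec, dotProduct]
  -- the coordinates of `f = δ_s ⊗ E` vanish off the fibre `q.1 = s` and are `≤ ‖E‖` on it
  have hfq : ∀ q : S × (Fin N × Fin N), ‖Bs.repr f q‖ ≤ if q.1 = s then ‖E‖ else 0 := fun q => by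
    rw [hrepr, hf]
    by_cases hq : q.1 = s
    · rw [if_pos hq, hq, Pi.single_eq_same]; exact Literature.Computability.QuantumComplexity.SolovayKitaev.norm_apply_le_norm E _ _
    · rw [if_neg hq, Pi.single_eq_of_ne hq, Matrix.zero_apply, norm_zero]
  have hcard : ∑ q : S × (Fin N × Fin N), (if q.1 = s then (1 : ℝ) else 0) = (N : ℝ) ^ 2 := by
    rw [← Finset.sum_filter, Finset.sum_const, nsmul_eq_mul, mul_one]
    have hset : (univ.filter fun q : S × (Fin N × Fin N) => q.1 = s) = ({s} : Finset S) ×ˢ (univ : Finset (Fin N × Fin N)) := by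
      ext q
      simp only [Finset.mem_filter, Finset.mem_univ, true_and, Finset.mem_product, Finset.mem_singleton, and_true]
    rw [hset, Finset.card_product, Finset.card_singleton, Finset.card_univ, Fintype.card_prod, Fintype.card_fin]
    push_cast; ring
  have hexp0 : 0 ≤ Real.exp (-(κ * tdist1 Nf (loc t) (loc s))) := (Real.exp_pos _).le
  have hentry : ∀ a b : Fin N, ‖(Φ f t) a b‖ ≤ (N : ℝ) ^ 2 * (B * Real.exp (-(κ * tdist1 Nf (loc t) (loc s))) * ‖E‖) := fun a b => by
    rw [hcoord a b]
    refine (norm_sum_le _ _).trans ?_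
    have h2 : ∑ q, ‖M (t, (a, b)) q * Bs.repr f q‖ ≤
        ∑ q : S × (Fin N × Fin N), (if q.1 = s then (1 : ℝ) else 0) * (B * Real.exp (-(κ * tdist1 Nf (loc t) (loc s))) * ‖E‖) := by
      refine Finset.sum_le_sum fun q _ => ?_
      rw [norm_mul]
      by_cases hq : q.1 = s
      · have hi : ‖M (t, (a, b)) q‖ ≤ B * Real.exp (-(κ * tdist1 Nf (loc t) (loc s))) := by
          simpa only [hq] using hdec (t, (a, b)) q
        have hfq' := hfq q
        rw [if_pos hq] at hfq'
        rw [if_pos hq, one_mul]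
        exact mul_le_mul hi hfq' (norm_nonneg _) (mul_nonneg hB hexp0)
      · have hfq' := hfq q
        rw [if_neg hq] at hfq'
        have h0 : ‖Bs.repr f q‖ = 0 := le_antisymm hfq' (norm_nonneg _)
        rw [h0, mul_zero, if_neg hq, zero_mul]
    rw [← Finset.sum_mul, hcard] at h2
    exact h2
  -- operator norm `≤` Hilbert–Schmidt `≤ N ·` the uniform entry bound
  set Y : ℝ := (N : ℝ) ^ 2 * (B * Real.exp (-(κ * tdist1 Nf (loc t) (loc s))) * ‖E‖) with hY
  have hY0 : 0 ≤ Y := by rw [hY]; exact mul_nonneg (by positivity) (mul_nonneg (mul_nonneg hB hexp0) (norm_nonneg _))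
  have hHS : ‖Φ f t‖ ^ 2 ≤ ((N : ℝ) * Y) ^ 2 := by
    calc ‖Φ f t‖ ^ 2 ≤ ∑ a, ∑ b, ‖(Φ f t) a b‖ ^ 2 := MatrixNorms.opNorm_sq_le_sum_norm_sq _
      _ ≤ ∑ _a : Fin N, ∑ _b : Fin N, Y ^ 2 := by
          refine Finset.sum_le_sum fun a _ => Finset.sum_le_sum fun b _ => ?_
          exact pow_le_pow_left₀ (norm_nonneg _) (hentry a b) 2
      _ = ((N : ℝ) * Y) ^ 2 := by
          simp only [Finset.sum_const, Finset.card_univ, Fintype.card_fin, nsmul_eq_mul]; ring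
  have hfin : ‖Φ f t‖ ≤ (N : ℝ) * Y := by
    have h := Real.sqrt_le_sqrt hHS
    rwa [Real.sqrt_sq (norm_nonneg _), Real.sqrt_sq (mul_nonneg (Nat.cast_nonneg _) hY0)] at h
  calc ‖Φ f t‖ ≤ (N : ℝ) * Y := hfin
    _ = (N : ℝ) ^ 3 * B * ‖E‖ * Real.exp (-(κ * tdist1 Nf (loc t) (loc s))) := by rw [hY]; ring

end Readout

section Theta

variable {d ℓ : ℕ} {hd : 1 ≤ d + 1} {hL : Odd (ℓ + 1) ∧ 1 < ℓ + 1} {b₀ b₁ : ℝ} (i : KIdx d ℓ hd hL b₀ b₁)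

/-- the block volumes compare by `(L^k)^{d+1}`: `W s ≤ (L^k)^{d+1}·W t` (`W(y) = (Lʲ)^{d+1}`, `1 ≤ j ≤ k`). [cite: Balaban1984PropagatorsII, (2.69) p.235, (2.3)–(2.4) p.224] -/
theorem wB_le_pow_mul_wB (s t : BlkY i) : wB i s ≤ ((((ℓ : ℝ) + 1) ^ i.k) ^ (d + 1)) * wB i t := by
  have hs := (scale_bounds i.D.toDomains s).2
  have hL1 : (1 : ℝ) ≤ (ℓ : ℝ) + 1 := by linarith [Nat.cast_nonneg (α := ℝ) ℓ]
  show B6Ineq268MultiLevelBox.W i.D.toDomains s ≤ ((((ℓ : ℝ) + 1) ^ i.k) ^ (d + 1)) * B6Ineq268MultiLevelBox.W i.D.toDomains t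
  rw [B6Ineq268MultiLevelBox.W_eq, B6Ineq268MultiLevelBox.W_eq]
  have h1 : (((ℓ : ℝ) + 1) ^ s.1.1) ^ (d + 1) ≤ (((ℓ : ℝ) + 1) ^ i.k) ^ (d + 1) :=
    pow_le_pow_left₀ (by positivity) (pow_le_pow_right₀ hL1 hs) _
  have h2 : (1 : ℝ) ≤ (((ℓ : ℝ) + 1) ^ t.1.1) ^ (d + 1) := one_le_pow₀ (one_le_pow₀ hL1)
  calc (((ℓ : ℝ) + 1) ^ s.1.1) ^ (d + 1) ≤ (((ℓ : ℝ) + 1) ^ i.k) ^ (d + 1) * 1 := by rw [mul_one]; exact h1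
    _ ≤ (((ℓ : ℝ) + 1) ^ i.k) ^ (d + 1) * (((ℓ : ℝ) + 1) ^ t.1.1) ^ (d + 1) := mul_le_mul_of_nonneg_left h2 (by positivity)

/-- ★ **THE WEIGHT-RATIO NUMERAL `Θ` OF MODULE 81, LOCATED**: `√W s ≤ √((L^k)^{d+1})·√W t` for any two blocks of the `k`-level geometry.
[cite: Balaban1984PropagatorsII, (2.69) p.235, (2.3)–(2.4) p.224; Balaban1985BackgroundPropagators, (3.48) p.398 (the factor `(Lʲ′η)^{−d}`)] -/
theorem sqrt_wB_le_mul_sqrt_wB (s t : BlkY i) : Real.sqrt (wB i s) ≤ Real.sqrt ((((ℓ : ℝ) + 1) ^ i.k) ^ (d + 1)) * Real.sqrt (wB i t) := by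
  rw [← Real.sqrt_mul (by positivity)]
  exact Real.sqrt_le_sqrt (wB_le_pow_mul_wB i s t)

end Theta

/-! ## §2. ★★ STEP (ii): the entry decay of the matrix of `X(U₀) = (Q′G′²Q′*)(U₀)` at def-Y's v4 letters — the `A′ = 0` clause of the X-station -/

section StepTwo

variable {d ℓ : ℕ} {hd : 1 ≤ d + 1} {hL : Odd (ℓ + 1) ∧ 1 < ℓ + 1} {b₀ b₁ : ℝ} (i : KIdx d ℓ hd hL b₀ b₁) {N : ℕ} [NeZero N]
variable {G : Subgroup (Matrix (Fin N) (Fin N) ℂ)ˣ} [DecidableEq (BlkY i)] {ν : ℕ} {Nf : Fin ν → ℕ} [∀ j, NeZero (Nf j)]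

/-- ★ **THE X-STATION AT def-Y's v4 LETTER FOR A `G`-VALUED BACKGROUND** (`G ≤ U(N)`: size numeral `K₀ = 1` by unitarity; the record's matrix units, `cb = cl = 1`): n10-w2's
`rawEntryLetters_toMatrix_XY_prodCfg_of` at `parSymY` with the lane's 78 §1 transporter facts, for ANY `Gp` with pencil letters `(R, ρ, B_G′)` on sites, `0 < R ≤ Rc` (`Rc` the
numeral radius of the bound `(e^{|η|Rc})^D`). [cite: Balaban1985BackgroundPropagators, (3.25) p.394, (3.35) p.396, (3.66)–(3.70) pp.403–404, Thm 3.10 (3.108) p.416; Balaban1988RG2Cluster, (2.5)–(2.6) p.12] -/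
theorem rawEntryLetters_toMatrix_XY_parSymY_prodCfg_of_mem (hG : G ≤ B7Prop2Explicit.unitaryUnits (Matrix (Fin N) (Fin N) ℂ))
    {U₀ : CfgY (Matrix (Fin N) (Fin N) ℂ) i} (hU : ∀ μ x, U₀ μ x ∈ G) (Gp : SiteOpY (Matrix (Fin N) (Fin N) ℂ) i) (η : ℝ)
    {R Rc : ℝ} (hR : 0 < R) (hRRc : R ≤ Rc) {D : ℕ}
    (hD : ∀ s z, qpK i s z ≠ 0 → Site.tdist ((boxEquiv i.hN).symm (blkCornerY i s)) ((boxEquiv i.hN).symm z) ≤ D)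
    (hDs : ∀ z s, qpsK i z s ≠ 0 → Site.tdist ((boxEquiv i.hN).symm (blkCornerY i s)) ((boxEquiv i.hN).symm z) ≤ D)
    {CQ CQs : ℝ} (hCQ0 : 0 ≤ CQ) (hCQ : ∀ s, ∑ z, |qpK i s z| ≤ CQ) (hCQs0 : 0 ≤ CQs) (hCQs : ∀ s, ∑ z, |qpsK i z s| ≤ CQs)
    (ℓS : SiteY i → UT Nf) (ℓB : BlkY i → UT Nf) {r : ℝ}
    (hℓQ : ∀ s z, qpK i s z ≠ 0 → tdist1 Nf (ℓB s) (ℓS z) ≤ r) (hℓQs : ∀ z s, qpsK i z s ≠ 0 → tdist1 Nf (ℓS z) (ℓB s) ≤ r)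
    {mS : ℕ} (hfibS : ∀ y : UT Nf, (univ.filter fun q : SiteY i × (Fin N × Fin N) => ℓS q.1 = y).card ≤ mS)
    {ρ BG μ : ℝ}
    (hGp : RawEntryLetters (fun a : Fin (d + 1) → Site (PV d ℓ i.m i.K hd hL) 0 → Matrix (Fin N) (Fin N) ℂ =>
      LinearMap.toMatrix
        ((Pi.basis fun _ : SiteY i => Matrix.stdBasis ℂ (Fin N) (Fin N)).reindex (Equiv.sigmaEquivProd (SiteY i) (Fin N × Fin N)))
        ((Pi.basis fun _ : SiteY i => Matrix.stdBasis ℂ (Fin N) (Fin N)).reindex (Equiv.sigmaEquivProd (SiteY i) (Fin N × Fin N)))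
        (Gp (prodCfg U₀ η a)))
      (fun q : SiteY i × (Fin N × Fin N) => ℓS q.1) R ρ BG)
    (hμ : 0 < μ) (hμρ : μ ≤ ρ) :
    RawEntryLetters (fun a : Fin (d + 1) → Site (PV d ℓ i.m i.K hd hL) 0 → Matrix (Fin N) (Fin N) ℂ =>
        LinearMap.toMatrix
          ((Pi.basis fun _ : BlkY i => Matrix.stdBasis ℂ (Fin N) (Fin N)).reindex (Equiv.sigmaEquivProd (BlkY i) (Fin N × Fin N)))
          ((Pi.basis fun _ : BlkY i => Matrix.stdBasis ℂ (Fin N) (Fin N)).reindex (Equiv.sigmaEquivProd (BlkY i) (Fin N × Fin N)))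
          (XY i (parSymY i) Gp (prodCfg U₀ η a)))
      (fun p : BlkY i × (Fin N × Fin N) => ℓB p.1) R (ρ - μ)
      (CQ * (Fintype.card (Fin N × Fin N) : ℝ) * (1 * ((1 * Real.exp (|η| * Rc)) ^ D * 1 * (1 * Real.exp (|η| * Rc)) ^ D)) *
        (CQs * (Fintype.card (Fin N × Fin N) : ℝ) * (1 * ((1 * Real.exp (|η| * Rc)) ^ D * 1 * (1 * Real.exp (|η| * Rc)) ^ D))) *
        (BG * BG * (mS * B6.c0 1 μ ^ ν)) * Real.exp (2 * (ρ - μ) * r)) := by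
  obtain ⟨hU1, hUi1⟩ := norm_unit_le_one_of_mem i hG hU
  have hRc : 0 ≤ Rc := hR.le.trans hRRc
  have h1 : (1 : ℝ) ≤ 1 * Real.exp (|η| * Rc) := by rw [one_mul]; exact Real.one_le_exp (mul_nonneg (abs_nonneg _) hRc)
  have hKQ : 0 ≤ (1 * Real.exp (|η| * Rc)) ^ D := pow_nonneg (zero_le_one.trans h1) D
  exact rawEntryLetters_toMatrix_XY_prodCfg_of i (Matrix.stdBasis ℂ (Fin N) (Fin N)) (parSymY i) U₀ η Gp
    norm_stdBasis_repr_le zero_le_one norm_stdBasis_le_one zero_le_one hKQ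
    (fun s z => differentiableOn_parSymY_prodCfg i U₀ η (blkCornerY i s) z)
    (fun s z => differentiableOn_parSymY_inv_prodCfg i U₀ η (blkCornerY i s) z)
    (fun a ha s z hM => (norm_parSymY_prodCfg_le i U₀ η hU1 hUi1 hRc (ball_subset_ball hRRc ha) (blkCornerY i s) z).trans
      (pow_le_pow_right₀ h1 (hD s z hM)))
    (fun a ha s z hM => (norm_parSymY_inv_prodCfg_le i U₀ η hU1 hUi1 hRc (ball_subset_ball hRRc ha) (blkCornerY i s) z).trans
      (pow_le_pow_right₀ h1 (hD s z hM)))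
    (fun a ha z s hM => (norm_parSymY_inv_prodCfg_le i U₀ η hU1 hUi1 hRc (ball_subset_ball hRRc ha) (blkCornerY i s) z).trans
      (pow_le_pow_right₀ h1 (hDs z s hM)))
    (fun a ha z s hM => (norm_parSymY_prodCfg_le i U₀ η hU1 hUi1 hRc (ball_subset_ball hRRc ha) (blkCornerY i s) z).trans
      (pow_le_pow_right₀ h1 (hDs z s hM)))
    hCQ0 hCQ hCQs0 hCQs ℓS ℓB hℓQ hℓQs hfibS hGp hμ hμρ

/-- ★★ **STEP (ii) MODULO `G′`'s PENCIL LETTERS — THE ENTRY DECAY OF THE MATRIX OF `X(U₀)` THROUGH THE BLOCK READING**: the `A′ = 0` clause (`prodCfg_zero`) of the X-station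
above, `‖toMatrix B′ B′ (X(U₀)) p q‖ ≤ a_X·e^{−(ρ−μ)·d₁(ℓB p, ℓB q)}` — EXACTLY module 81's binder `hXdec` at `loc := ℓB ∘ fst`.
[cite: Balaban1985BackgroundPropagators, (3.25) p.394, (3.66)–(3.70) pp.403–404, Thm 3.10 (3.107)–(3.108) p.416; Balaban1988RG2Cluster, (2.5)–(2.6) p.12] -/
theorem norm_toMatrix_XY_parSymY_le_of_letters (hG : G ≤ B7Prop2Explicit.unitaryUnits (Matrix (Fin N) (Fin N) ℂ))
    {U₀ : CfgY (Matrix (Fin N) (Fin N) ℂ) i} (hU : ∀ μ x, U₀ μ x ∈ G) (Gp : SiteOpY (Matrix (Fin N) (Fin N) ℂ) i) (η : ℝ)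
    {R Rc : ℝ} (hR : 0 < R) (hRRc : R ≤ Rc) {D : ℕ}
    (hD : ∀ s z, qpK i s z ≠ 0 → Site.tdist ((boxEquiv i.hN).symm (blkCornerY i s)) ((boxEquiv i.hN).symm z) ≤ D)
    (hDs : ∀ z s, qpsK i z s ≠ 0 → Site.tdist ((boxEquiv i.hN).symm (blkCornerY i s)) ((boxEquiv i.hN).symm z) ≤ D)
    {CQ CQs : ℝ} (hCQ0 : 0 ≤ CQ) (hCQ : ∀ s, ∑ z, |qpK i s z| ≤ CQ) (hCQs0 : 0 ≤ CQs) (hCQs : ∀ s, ∑ z, |qpsK i z s| ≤ CQs)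
    (ℓS : SiteY i → UT Nf) (ℓB : BlkY i → UT Nf) {r : ℝ}
    (hℓQ : ∀ s z, qpK i s z ≠ 0 → tdist1 Nf (ℓB s) (ℓS z) ≤ r) (hℓQs : ∀ z s, qpsK i z s ≠ 0 → tdist1 Nf (ℓS z) (ℓB s) ≤ r)
    {mS : ℕ} (hfibS : ∀ y : UT Nf, (univ.filter fun q : SiteY i × (Fin N × Fin N) => ℓS q.1 = y).card ≤ mS)
    {ρ BG μ : ℝ}
    (hGp : RawEntryLetters (fun a : Fin (d + 1) → Site (PV d ℓ i.m i.K hd hL) 0 → Matrix (Fin N) (Fin N) ℂ =>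
      LinearMap.toMatrix
        ((Pi.basis fun _ : SiteY i => Matrix.stdBasis ℂ (Fin N) (Fin N)).reindex (Equiv.sigmaEquivProd (SiteY i) (Fin N × Fin N)))
        ((Pi.basis fun _ : SiteY i => Matrix.stdBasis ℂ (Fin N) (Fin N)).reindex (Equiv.sigmaEquivProd (SiteY i) (Fin N × Fin N)))
        (Gp (prodCfg U₀ η a)))
      (fun q : SiteY i × (Fin N × Fin N) => ℓS q.1) R ρ BG)
    (hμ : 0 < μ) (hμρ : μ ≤ ρ) (p q : BlkY i × (Fin N × Fin N)) :
    ‖LinearMap.toMatrix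
        ((Pi.basis fun _ : BlkY i => Matrix.stdBasis ℂ (Fin N) (Fin N)).reindex (Equiv.sigmaEquivProd (BlkY i) (Fin N × Fin N)))
        ((Pi.basis fun _ : BlkY i => Matrix.stdBasis ℂ (Fin N) (Fin N)).reindex (Equiv.sigmaEquivProd (BlkY i) (Fin N × Fin N)))
        (XY i (parSymY i) Gp U₀) p q‖ ≤
      (CQ * (Fintype.card (Fin N × Fin N) : ℝ) * (1 * ((1 * Real.exp (|η| * Rc)) ^ D * 1 * (1 * Real.exp (|η| * Rc)) ^ D)) *
        (CQs * (Fintype.card (Fin N × Fin N) : ℝ) * (1 * ((1 * Real.exp (|η| * Rc)) ^ D * 1 * (1 * Real.exp (|η| * Rc)) ^ D))) *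
        (BG * BG * (mS * B6.c0 1 μ ^ ν)) * Real.exp (2 * (ρ - μ) * r)) *
        Real.exp (-((ρ - μ) * tdist1 Nf (ℓB p.1) (ℓB q.1))) := by
  have hX := rawEntryLetters_toMatrix_XY_parSymY_prodCfg_of_mem i hG hU Gp η hR hRRc hD hDs hCQ0 hCQ hCQs0 hCQs ℓS ℓB hℓQ hℓQs hfibS hGp hμ hμρ
  have h := hX.decay 0 (mem_ball_self hR) p q
  simpa only [prodCfg_zero] using h

/-! ## §3. ★★★ The X⁻¹-junction's N06 binders at def-Y's v4 letters: `IsUnit (X(U₀))` and the kernel decay of `X(U₀)⁻¹` -/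

/-- ★★★ **THE X⁻¹ CENTRE FACT MODULO `G′`'s PENCIL LETTERS.**  At EVERY `G`-valued `U₀` (`G ≤ U(N)`, NO smallness of the background; `m = (4(d+1)+1)⁻²` by n06-w1), given the
pencil letters `(R, ρ, B_G′)` of `G′ = GpY i (parSymY i)` (DISPLAYED), NODE 00's numerals `D, CQ, CQs, r`, fibre bounds `m_S, m_B`, a rate loss `0 < μ < ρ` and ONE located rate `κ`
(`0 ≤ κ ≤ (ρ−μ)∕4`, `8·(Θ·a_X)·κ·c_V ≤ m·(ρ−μ)`, `Θ = √((L^k)^{d+1})`, `c_V = m_B·c₀(1,(ρ−μ)∕2)^ν`): `X(U₀)` is a unit and `‖X(U₀)⁻¹(δ_s ⊗ E)(t)‖ ≤ N³·(Θ·(4∕m))·‖E‖·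
e^{−κ·d₁(ℓB t, ℓB s)}` — 81 ∘ §2 ∘ §1; the X⁻¹-junction's `hunit ∕ hO` at v4 (after `rawEntryLetters_mono` of the X-letters' rate down to `κ`).
[cite: Balaban1985BackgroundPropagators, (3.25) p.394, Thm 3.2 (3.48) pp.398–399, Thm 3.10 (3.108) p.416, Thm 3.11 p.416; Balaban1984PropagatorsII, Prop 2.3 p.238; Balaban1988RG2Cluster, (2.5)–(2.7) pp.12–13] -/
theorem norm_XinvY_parSymY_single_le_of_letters (hG : G ≤ B7Prop2Explicit.unitaryUnits (Matrix (Fin N) (Fin N) ℂ))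
    {U₀ : CfgY (Matrix (Fin N) (Fin N) ℂ) i} (hU : ∀ μ x, U₀ μ x ∈ G) (η : ℝ)
    {R Rc : ℝ} (hR : 0 < R) (hRRc : R ≤ Rc) {D : ℕ}
    (hD : ∀ s z, qpK i s z ≠ 0 → Site.tdist ((boxEquiv i.hN).symm (blkCornerY i s)) ((boxEquiv i.hN).symm z) ≤ D)
    (hDs : ∀ z s, qpsK i z s ≠ 0 → Site.tdist ((boxEquiv i.hN).symm (blkCornerY i s)) ((boxEquiv i.hN).symm z) ≤ D)
    {CQ CQs : ℝ} (hCQ0 : 0 ≤ CQ) (hCQ : ∀ s, ∑ z, |qpK i s z| ≤ CQ) (hCQs0 : 0 ≤ CQs) (hCQs : ∀ s, ∑ z, |qpsK i z s| ≤ CQs)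
    (ℓS : SiteY i → UT Nf) (ℓB : BlkY i → UT Nf) {r : ℝ}
    (hℓQ : ∀ s z, qpK i s z ≠ 0 → tdist1 Nf (ℓB s) (ℓS z) ≤ r) (hℓQs : ∀ z s, qpsK i z s ≠ 0 → tdist1 Nf (ℓS z) (ℓB s) ≤ r)
    {mS mB : ℕ} (hfibS : ∀ y : UT Nf, (univ.filter fun q : SiteY i × (Fin N × Fin N) => ℓS q.1 = y).card ≤ mS)
    (hfibB : ∀ y : UT Nf, (univ.filter fun p : BlkY i × (Fin N × Fin N) => ℓB p.1 = y).card ≤ mB)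
    {ρ BG μ : ℝ}
    (hGp : RawEntryLetters (fun a : Fin (d + 1) → Site (PV d ℓ i.m i.K hd hL) 0 → Matrix (Fin N) (Fin N) ℂ =>
      LinearMap.toMatrix
        ((Pi.basis fun _ : SiteY i => Matrix.stdBasis ℂ (Fin N) (Fin N)).reindex (Equiv.sigmaEquivProd (SiteY i) (Fin N × Fin N)))
        ((Pi.basis fun _ : SiteY i => Matrix.stdBasis ℂ (Fin N) (Fin N)).reindex (Equiv.sigmaEquivProd (SiteY i) (Fin N × Fin N)))
        (GpY i (parSymY i) (prodCfg U₀ η a)))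
      (fun q : SiteY i × (Fin N × Fin N) => ℓS q.1) R ρ BG)
    (hμ : 0 < μ) (hμρ : μ < ρ)
    {κ : ℝ} (hκ : 0 ≤ κ) (hκ4 : κ ≤ (ρ - μ) / 4)
    (hκm : 8 * (Real.sqrt ((((ℓ : ℝ) + 1) ^ i.k) ^ (d + 1)) *
        (CQ * (Fintype.card (Fin N × Fin N) : ℝ) * (1 * ((1 * Real.exp (|η| * Rc)) ^ D * 1 * (1 * Real.exp (|η| * Rc)) ^ D)) *
          (CQs * (Fintype.card (Fin N × Fin N) : ℝ) * (1 * ((1 * Real.exp (|η| * Rc)) ^ D * 1 * (1 * Real.exp (|η| * Rc)) ^ D))) *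
          (BG * BG * (mS * B6.c0 1 μ ^ ν)) * Real.exp (2 * (ρ - μ) * r))) * κ * (mB * B6.c0 1 ((ρ - μ) / 2) ^ ν) ≤
      ((4 * ((d : ℝ) + 1) + 1) ^ 2)⁻¹ * (ρ - μ)) :
    IsUnit (XY i (parSymY i) (GpY i (parSymY i)) U₀) ∧ ∀ s t (E : Matrix (Fin N) (Fin N) ℂ),
      ‖XinvY i (parSymY i) (GpY i (parSymY i)) U₀ (Pi.single s E) t‖ ≤
        (N : ℝ) ^ 3 * (Real.sqrt ((((ℓ : ℝ) + 1) ^ i.k) ^ (d + 1)) * (4 / ((4 * ((d : ℝ) + 1) + 1) ^ 2)⁻¹)) * ‖E‖ *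
          Real.exp (-(κ * tdist1 Nf (ℓB t) (ℓB s))) := by
  have hX := rawEntryLetters_toMatrix_XY_parSymY_prodCfg_of_mem i hG hU (GpY i (parSymY i)) η hR hRRc hD hDs hCQ0 hCQ hCQs0 hCQs ℓS ℓB hℓQ hℓQs
    hfibS hGp hμ hμρ.le
  have hdec := norm_toMatrix_XY_parSymY_le_of_letters i hG hU (GpY i (parSymY i)) η hR hRRc hD hDs hCQ0 hCQ hCQs0 hCQs ℓS ℓB hℓQ hℓQs hfibS hGp hμ hμρ.le
  have hκ₀ : 0 < ρ - μ := by linarith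
  obtain ⟨hunit, hinv⟩ := norm_toMatrix_XinvY_parSymY_le_of_unitary_fibre i hG hU (fun p : BlkY i × (Fin N × Fin N) => ℓB p.1) hfibB
    hX.B_nonneg hκ₀ hdec (sqrt_wB_le_mul_sqrt_wB i) hκ hκ4 hκm
  refine ⟨hunit, fun s t E => ?_⟩
  have hB0 : 0 ≤ Real.sqrt ((((ℓ : ℝ) + 1) ^ i.k) ^ (d + 1)) * (4 / ((4 * ((d : ℝ) + 1) + 1) ^ 2)⁻¹) :=
    mul_nonneg (Real.sqrt_nonneg _) (div_nonneg (by norm_num) (by positivity))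
  exact norm_apply_single_le_of_toMatrix_piStd_decay (XinvY i (parSymY i) (GpY i (parSymY i)) U₀) ℓB hB0 hinv s t E

/-- ★★★ **THE X⁻¹ CENTRE FACT ON THE (3.35) CLASS** — `G′`'s letters DISCHARGED by the lane's 79 (`…GpY_parSymY_prodCfg_of_reg335_record`: n06-w1's Thm 3.1 decay + dag-n06-j's
invertibility, record coordinates): for EVERY `U₀ ∈ (bg9K (M_N ℂ) G i).Reg335 c α₀` (`G ≤ U(N)`, `0 ≤ c·M·α₀`, `c·M·α₀·(d+1) ≤ 1∕16`), `X(U₀) = (Q′G′²Q′*)(U₀)` is a unit and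
`‖X(U₀)⁻¹(δ_s ⊗ E)(t)‖ ≤ N³·(Θ·(4∕m))·‖E‖·e^{−κ·d₁(ℓB t, ℓB s)}`, displaying ONLY NODE 00's dictionary numerals (`D′, Cavg`; `D, CQ, CQs`; readings `ℓS, ℓB` with `s, κr, r`; fibre
bounds `m_S, m_B`), the pencil's `η` and `Rc > 0`, `G′`'s target rate `0 ≤ ρ′ < δ₀κr`, a rate loss `0 < μ < ρ′` and ONE located rate `κ` with its smallness — print's Thm 3.2 (3.48)
for def-Y's operator at one finite lattice, in the junction's currency. [cite: Balaban1985BackgroundPropagators, (3.35) p.396, Thm 3.1 (3.42) p.397, Thm 3.2 (3.48) pp.398–399,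
Thm 3.10 (3.108) p.416; Balaban1984PropagatorsII, Prop 2.3 p.238, Lemma 2.1 (2.61) p.234; Balaban1988RG2Cluster, (2.5)–(2.7) pp.12–13, p.15] -/
theorem norm_XinvY_parSymY_single_le_of_reg335 (hG : G ≤ B7Prop2Explicit.unitaryUnits (Matrix (Fin N) (Fin N) ℂ))
    {U₀ : CfgY (Matrix (Fin N) (Fin N) ℂ) i} {c α₀ : ℝ} (hC0 : 0 ≤ c * (kGeo i).M * α₀) (hC1 : c * (kGeo i).M * α₀ * ((d : ℝ) + 1) ≤ 1 / 16)
    (hreg : (bg9K (Matrix (Fin N) (Fin N) ℂ) G i).Reg335 c α₀ U₀)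
    (η : ℝ) {Rc : ℝ} (hRc : 0 < Rc) {D' : ℕ}
    (hD' : ∀ z w, avgCoeffY i z w ≠ 0 →
      Site.tdist ((boxEquiv i.hN).symm z) ((boxEquiv i.hN).symm (cornerY i (levY i z) z)) +
        Site.tdist ((boxEquiv i.hN).symm (cornerY i (levY i z) z)) ((boxEquiv i.hN).symm w) ≤ D')
    {Cavg : ℝ} (hCavg0 : 0 ≤ Cavg) (hCavg : ∀ z, ∑ w, |avgCoeffY i z w| ≤ Cavg)
    {D : ℕ}
    (hD : ∀ s z, qpK i s z ≠ 0 → Site.tdist ((boxEquiv i.hN).symm (blkCornerY i s)) ((boxEquiv i.hN).symm z) ≤ D)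
    (hDs : ∀ z s, qpsK i z s ≠ 0 → Site.tdist ((boxEquiv i.hN).symm (blkCornerY i s)) ((boxEquiv i.hN).symm z) ≤ D)
    {CQ CQs : ℝ} (hCQ0 : 0 ≤ CQ) (hCQ : ∀ s, ∑ z, |qpK i s z| ≤ CQ) (hCQs0 : 0 ≤ CQs) (hCQs : ∀ s, ∑ z, |qpsK i z s| ≤ CQs)
    (ℓS : SiteY i → UT Nf) (ℓB : BlkY i → UT Nf) {s : ℝ} (hs0 : 0 ≤ s)
    (hℓ : ∀ μ z, tdist1 Nf (ℓS (shiftY i μ z)) (ℓS z) ≤ s) (hℓa : ∀ z w, avgCoeffY i z w ≠ 0 → tdist1 Nf (ℓS z) (ℓS w) ≤ s)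
    {κr : ℝ} (hκ0 : 0 ≤ κr)
    (hκr : ∀ z w : SiteY i, κr * tdist1 Nf (ℓS z) (ℓS w) ≤ ((((ℓ + 1) ^ i.k : ℕ) : ℝ))⁻¹ * torusSupNorm (toKT i).NB (z.1 - w.1))
    {r : ℝ} (hℓQ : ∀ s z, qpK i s z ≠ 0 → tdist1 Nf (ℓB s) (ℓS z) ≤ r) (hℓQs : ∀ z s, qpsK i z s ≠ 0 → tdist1 Nf (ℓS z) (ℓB s) ≤ r)
    {mS mB : ℕ} (hfibS : ∀ y : UT Nf, (univ.filter fun q : SiteY i × (Fin N × Fin N) => ℓS q.1 = y).card ≤ mS)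
    (hfibB : ∀ y : UT Nf, (univ.filter fun p : BlkY i × (Fin N × Fin N) => ℓB p.1 = y).card ≤ mB)
    {ρ' : ℝ} (hρ'0 : 0 ≤ ρ') (hρ' : ρ' < (1 / (4 * ((d : ℝ) + 2))) * κr)
    {μ : ℝ} (hμ : 0 < μ) (hμρ : μ < ρ')
    {κ : ℝ} (hκ : 0 ≤ κ) (hκ4 : κ ≤ (ρ' - μ) / 4)
    (hκm : 8 * (Real.sqrt ((((ℓ : ℝ) + 1) ^ i.k) ^ (d + 1)) *
        (CQ * (Fintype.card (Fin N × Fin N) : ℝ) * (1 * ((1 * Real.exp (|η| * Rc)) ^ D * 1 * (1 * Real.exp (|η| * Rc)) ^ D)) *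
          (CQs * (Fintype.card (Fin N × Fin N) : ℝ) * (1 * ((1 * Real.exp (|η| * Rc)) ^ D * 1 * (1 * Real.exp (|η| * Rc)) ^ D))) *
          ((2 * (1 * 1 * (16 * ((((ℓ + 1) ^ i.k : ℕ) : ℝ)) ^ 2 * Real.sqrt N))) * (2 * (1 * 1 * (16 * ((((ℓ + 1) ^ i.k : ℕ) : ℝ)) ^ 2 * Real.sqrt N))) *
            (mS * B6.c0 1 μ ^ ν)) * Real.exp (2 * (ρ' - μ) * r))) * κ * (mB * B6.c0 1 ((ρ' - μ) / 2) ^ ν) ≤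
      ((4 * ((d : ℝ) + 1) + 1) ^ 2)⁻¹ * (ρ' - μ)) :
    IsUnit (XY i (parSymY i) (GpY i (parSymY i)) U₀) ∧ ∀ s' t (E : Matrix (Fin N) (Fin N) ℂ),
      ‖XinvY i (parSymY i) (GpY i (parSymY i)) U₀ (Pi.single s' E) t‖ ≤
        (N : ℝ) ^ 3 * (Real.sqrt ((((ℓ : ℝ) + 1) ^ i.k) ^ (d + 1)) * (4 / ((4 * ((d : ℝ) + 1) + 1) ^ 2)⁻¹)) * ‖E‖ *
          Real.exp (-(κ * tdist1 Nf (ℓB t) (ℓB s'))) := by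
  -- `G′`'s letters on the class (lane module 79, record coordinates) at its located thin radius `R⋆ ≤ Rc`
  have hGp := rawEntryLetters_toMatrix_GpY_parSymY_prodCfg_of_reg335_record i hG hC0 hC1 hreg η hRc hD' hCavg0 hCavg ℓS hs0 hℓ hℓa hκ0 hκr hfibS hρ'0 hρ'
  refine norm_XinvY_parSymY_single_le_of_letters i hG hreg.1 η (thinRadius_pos hRc ?_) (thinRadius_le hRc.le ?_) hD hDs hCQ0 hCQ hCQs0 hCQs ℓS ℓB hℓQ hℓQs
    hfibS hfibB hGp hμ hμρ hκ hκ4 hκm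
  all_goals
    exact mul_nonneg (mul_nonneg (mul_nonneg
      (mul_nonneg (mul_nonneg zero_le_one (add_nonneg (by positivity) (mul_nonneg hCavg0 (by positivity)))) (Real.exp_pos _).le)
      (by positivity)) (mul_nonneg (Nat.cast_nonneg _) (pow_nonneg (B6RandomWalk.c0_nonneg 1 _) ν))) (mul_nonneg (Nat.cast_nonneg _) (pow_nonneg (B6RandomWalk.c0_nonneg 1 _) ν))

end StepTwo

end Literature.MathematicalPhysics.QuantumFieldTheory.Balaban1983to89.B13XinvCentreDecayOfReg335

end
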